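import Mathlib

/-!
# The `V₃` relations along an order-three Jordan chain (solo-blind notes, §20)

Let `A` be a commutative ring with `3 = 0`, `σ : A →+* A` a ring endomorphism and `t : A` with
`σ (σ (σ t)) = t`.  Put `v := σ t - t`, `u := σ v - v` (so `(t, v, u)` is a Jordan chain:
`σ t = t + v`, `σ v = v + u`, `σ u = u`), and
* `d := v ^ 2 + u * t - u * v`,
* `n := v * σ v * σ (σ v)` (the norm of `v`), `ε := t * σ t * σ (σ t)` (the norm of `t`).

We prove: `u = t + σ t + σ (σ t)` (the trace of `t`), `σ u = u`, `σ d = d`,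
`d = -(t σt + t σ²t + σt σ²t)` (minus the second symmetric function of the orbit of `t`),
`n = v ^ 3 - u ^ 2 * v`, `σ n = n`, `σ ε = ε`, and the single relation
`n ^ 2 = d ^ 3 + u ^ 2 * d ^ 2 - ε * u ^ 3`.

These are exactly the generators and the relation of the modular invariant ring
`k[x₁,x₂,x₃]^{C₃} = k[x₁, d, N(x₂), N(x₃)] / (N(x₂)² − d³ − x₁² d² + x₁³ N(x₃))`
(`σ x₃ = x₃ + x₂`, `σ x₂ = x₂ + x₁`, `σ x₁ = x₁`, characteristic `3`), transported along the
`σ`-equivariant homomorphism `x₁ ↦ u, x₂ ↦ v, x₃ ↦ t`.  In the notes they are applied with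
`A = B̂_𝔮` the completed local ring of a regular threefold germ at the generic point of a
generically reduced free fixed curve of an order-`3` automorphism, where `t` lifts a uniformiser
of the curve: then `(u, d, n)` present the completed invariant ring at that point
(Theorem 20.2: `R̂_𝔮' = K₁⟦u, d⟧[n] / (n² − d³ − u²d² + ε u³)`).

All proofs are polynomial identities: each difference is `3 · Q` for an explicit integer
polynomial `Q` in `t, σ t, σ (σ t)`.
-/

namespace Summit.ResolutionOfSingularities.ResolutionOfSingularities.Theorems
namespace SoloBlind

section JordanChainThree

variable {A : Type*} [CommRing A] (σ : A →+* A) (t : A)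

/-- `σ³ t = t` gives `σ` applied three times to anything built from `t`. -/
theorem v3_sigma_cube_sigma (ht : σ (σ (σ t)) = t) : σ (σ (σ (σ t))) = σ t := by
  rw [ht]

/-- The top of the chain is the trace: `u = σ²t - 2σt + t = t + σt + σ²t` when `3 = 0`. -/
theorem v3_u_eq_trace (h3 : (3 : A) = 0) (v u : A) (hv : v = σ t - t) (hu : u = σ v - v) :
    u = t + σ t + σ (σ t) := by
  subst hv; subst hu
  simp only [map_sub]
  linear_combination (-(σ t)) * h3

/-- The top of the chain is invariant: `σ u = u` (uses `σ³ t = t` and `3 = 0`). -/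
theorem v3_sigma_u (h3 : (3 : A) = 0) (ht : σ (σ (σ t)) = t) (v u : A) (hv : v = σ t - t)
    (hu : u = σ v - v) : σ u = u := by
  subst hv; subst hu
  simp only [map_sub, ht]
  linear_combination ((-1) * (σ (σ t)) + (σ t)) * h3

/-- The norm of `v` in closed form: `v · σv · σ²v = v³ - u² v` when `3 = 0`. -/
theorem v3_norm_v (h3 : (3 : A) = 0) (ht : σ (σ (σ t)) = t) (v u n : A) (hv : v = σ t - t)
    (hu : u = σ v - v) (hn : n = v * σ v * σ (σ v)) : n = v ^ 3 - u ^ 2 * v := by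
  subst hv; subst hu; subst hn
  simp only [map_sub, ht]
  linear_combination ((-1) * (σ t)^2 * (σ (σ t)) + (σ t)^3 + (2) * t * (σ t) * (σ (σ t))
    + (-2) * t * (σ t)^2 + (-1) * t^2 * (σ (σ t)) + t^2 * (σ t)) * h3

/-- `d = v² + u t - u v` is minus the second elementary symmetric function of the orbit of `t`. -/
theorem v3_d_eq_neg_e2 (h3 : (3 : A) = 0) (v u d : A) (hv : v = σ t - t)
    (hu : u = σ v - v) (hd : d = v ^ 2 + u * t - u * v) :
    d = -(t * σ t + t * σ (σ t) + σ t * σ (σ t)) := by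
  subst hv; subst hu; subst hd
  simp only [map_sub]
  linear_combination ((σ t)^2 + t * (σ (σ t)) + (-2) * t * (σ t) + t^2) * h3

/-- `d` is `σ`-invariant. -/
theorem v3_sigma_d (h3 : (3 : A) = 0) (ht : σ (σ (σ t)) = t) (v u d : A) (hv : v = σ t - t)
    (hu : u = σ v - v) (hd : d = v ^ 2 + u * t - u * v) : σ d = d := by
  subst hv; subst hu; subst hd
  simp only [map_sub, map_add, map_mul, map_pow, ht]
  linear_combination ((σ (σ t))^2 + (-2) * (σ t) * (σ (σ t)) + (-1) * t * (σ (σ t))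
    + (3) * t * (σ t) + (-1) * t^2) * h3

/-- The norm of `t` is `σ`-invariant (no characteristic hypothesis). -/
theorem v3_sigma_eps (ht : σ (σ (σ t)) = t) (ε : A) (hε : ε = t * σ t * σ (σ t)) : σ ε = ε := by
  subst hε
  simp only [map_mul, ht]
  ring

/-- The norm of `v` is `σ`-invariant (no characteristic hypothesis). -/
theorem v3_sigma_n (ht : σ (σ (σ t)) = t) (v n : A) (hv : v = σ t - t)
    (hn : n = v * σ v * σ (σ v)) : σ n = n := by
  subst hv; subst hn
  simp only [map_mul, map_sub, ht]
  ring

/-- **The `V₃` relation.**  With `v = σt - t`, `u = σv - v`, `d = v² + ut - uv`,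
`n = N(v)`, `ε = N(t)`: `n² = d³ + u² d² - ε u³`, in any commutative ring with `3 = 0`
(for any ring endomorphism `σ` with `σ³ t = t`). -/
theorem v3_relation (h3 : (3 : A) = 0) (ht : σ (σ (σ t)) = t) (v u d n ε : A)
    (hv : v = σ t - t) (hu : u = σ v - v) (hd : d = v ^ 2 + u * t - u * v)
    (hn : n = v * σ v * σ (σ v)) (hε : ε = t * σ t * σ (σ t)) :
    n ^ 2 = d ^ 3 + u ^ 2 * d ^ 2 - ε * u ^ 3 := by
  subst hv; subst hu; subst hd; subst hn; subst hε
  simp only [map_sub, ht]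
  linear_combination ((3) * (σ t)^3 * (σ (σ t))^3 + (-15) * (σ t)^4 * (σ (σ t))^2
    + (29) * (σ t)^5 * (σ (σ t)) + (-21) * (σ t)^6 + t * (σ t) * (σ (σ t))^4
    + (-18) * t * (σ t)^2 * (σ (σ t))^3 + (83) * t * (σ t)^3 * (σ (σ t))^2
    + (-168) * t * (σ t)^4 * (σ (σ t)) + (131) * t * (σ t)^5 + (-1) * t^2 * (σ (σ t))^4
    + (25) * t^2 * (σ t) * (σ (σ t))^3 + (-145) * t^2 * (σ t)^2 * (σ (σ t))^2
    + (355) * t^2 * (σ t)^3 * (σ (σ t)) + (-322) * t^2 * (σ t)^4 + (-10) * t^3 * (σ (σ t))^3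
    + (101) * t^3 * (σ t) * (σ (σ t))^2 + (-348) * t^3 * (σ t)^2 * (σ (σ t))
    + (399) * t^3 * (σ t)^3 + (-24) * t^4 * (σ (σ t))^2 + (160) * t^4 * (σ t) * (σ (σ t))
    + (-264) * t^4 * (σ t)^2 + (-28) * t^5 * (σ (σ t)) + (89) * t^5 * (σ t)
    + (-12) * t^6) * h3

/-- The `V₃` relation under the typeclass hypothesis `CharP A 3`. -/
theorem v3_relation_charP [CharP A 3] (ht : σ (σ (σ t)) = t) (v u d n ε : A)
    (hv : v = σ t - t) (hu : u = σ v - v) (hd : d = v ^ 2 + u * t - u * v)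
    (hn : n = v * σ v * σ (σ v)) (hε : ε = t * σ t * σ (σ t)) :
    n ^ 2 = d ^ 3 + u ^ 2 * d ^ 2 - ε * u ^ 3 := by
  have h3 : (3 : A) = 0 := by exact_mod_cast CharP.cast_eq_zero A 3
  exact v3_relation σ t h3 ht v u d n ε hv hu hd hn hε

/-- Summary (Theorem 20.2, algebraic part): along an order-three Jordan chain the four
elements `u, d, n, ε` are `σ`-invariant and satisfy the `V₃` relation. -/
theorem v3_invariants_and_relation (h3 : (3 : A) = 0) (ht : σ (σ (σ t)) = t) (v u d n ε : A)
    (hv : v = σ t - t) (hu : u = σ v - v) (hd : d = v ^ 2 + u * t - u * v)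
    (hn : n = v * σ v * σ (σ v)) (hε : ε = t * σ t * σ (σ t)) :
    σ u = u ∧ σ d = d ∧ σ n = n ∧ σ ε = ε ∧ u = t + σ t + σ (σ t) ∧
      n = v ^ 3 - u ^ 2 * v ∧ n ^ 2 = d ^ 3 + u ^ 2 * d ^ 2 - ε * u ^ 3 :=
  ⟨v3_sigma_u σ t h3 ht v u hv hu, v3_sigma_d σ t h3 ht v u d hv hu hd,
    v3_sigma_n σ t ht v n hv hn, v3_sigma_eps σ t ht ε hε, v3_u_eq_trace σ t h3 v u hv hu,
    v3_norm_v σ t h3 ht v u n hv hu hn, v3_relation σ t h3 ht v u d n ε hv hu hd hn hε⟩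

end JordanChainThree

end SoloBlind
end Summit.ResolutionOfSingularities.ResolutionOfSingularities.Theorems
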